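import Literature.Probability.RandomPlanarGeometry.HalfPlaneFill
import Literature.Analysis.Complex.SimplyConnectedOfCompl
import HarnessLib

/-!
# Discharge of `Literature.Probability.RandomPlanarGeometry.isSimplyConnected_of_isConnected_compl`

The named fact `Literature.Probability.RandomPlanarGeometry.isSimplyConnected_of_isConnected_compl` of `HalfPlaneFill` (Conway (1978),
Thm. VIII.2.2, (c) ⇒ (a): an open connected `G ⊆ ℂ` whose complement is connected and unbounded
is simply connected) is PROVED from the tree's `Complex.isSimplyConnected_of_compl`
(`Literature.Analysis.Complex.SimplyConnectedOfCompl`: no bounded component of `ℂ ∖ G` ⇒ simply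
connected, via Runge ⇒ square roots ⇒ the Riemann map): the complement being connected, its only
component is `ℂ ∖ G` itself, which is unbounded by hypothesis.

* J. B. Conway, *Functions of One Complex Variable I*, 2nd ed., GTM 11, Springer (1978),
  Thm. VIII.2.2.
-/

noncomputable section

open Set Bornology

namespace Literature.Probability.RandomPlanarGeometry

/-- **Conway VIII.2.2, (c) ⇒ (a), unbounded-complement form** (`isSimplyConnected_of_isConnected_compl`
holds): if `G ⊆ ℂ` is open and connected and `ℂ ∖ G` is connected and unbounded, then `G` is
simply connected — the unique component `ℂ ∖ G` of the complement is unbounded, so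
`Complex.isSimplyConnected_of_compl` applies. [cite: Conway1978, Ch. VIII Thm. 2.2 ((c)⇒(a))] -/
theorem isSimplyConnected_of_isConnected_compl_holds : isSimplyConnected_of_isConnected_compl := by
  intro G hG hGc hcompl hunb
  refine Complex.isSimplyConnected_of_compl hG hGc fun a ha hb ↦ hunb (hb.subset ?_)
  exact hcompl.isPreconnected.subset_connectedComponentIn ha subset_rfl

end Literature.Probability.RandomPlanarGeometry

end
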